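import Mathlib
import Summits.Ventures.PercRepro2.TypedHatPair
import Summits.Ventures.PercRepro2.TypedHatClass

/-!
# The hat class is closed: the crux of record from (TRI) on the core with an unmarked typed
vertex that is not a hat (blind cell PercRepro2, p2 g0, 2026-08-25; sub-claim S1; the lead's
ruling 05:03:47Z (3), mine-1's MINE1-J1.md §23.11)

A **hat** is an unmarked vertex whose typed edges are exactly three: to a vertex `v ∉ {u, a₁, a₂}`
(a mark or another hat), to `a₁` and to `a₂` (`IsHat`). If every unmarked vertex touched by the
typed set is a hat (`Hats`), the hats are eliminated one at a time — a hat with a marked third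
neighbour by the hat rule (`typedCount_hat`), a hat whose third neighbour is another hat together
with that hat (`nonneg_of_hatPair`: the two are adjacent, and after the hat rule the second one is
a root vertex) — by induction on `|F|`, down to the all-marked loop-free multigraph base
(typer-1's `K5.typedCount_K3_nonneg_multi`):

* **`typedCount_nonneg_of_hats`** — row 2′TRI on every loop-free typed graph with `MarksDistinct`
  marks whose unmarked typed vertices are all hats;
* **`ResidualCoreNHat`** — the core with an unmarked typed vertex that is NOT a hat (`¬ Hats`);
  **`HCov_all_of_residualCoreNHat_all : ResidualCoreNHat_all R → HCov_all R`** — UNCONDITIONAL.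
  `ResidualCoreNHat ⊆ ResidualCoreNH ⊆ ResidualCoreU`.

Own code; standard axioms.
-/

namespace Summit.Ventures.PercRepro2

open UnionCluster

namespace CovForm

namespace TypedRed

/-! ## Hats -/

section Hats

variable {V : Type*} {E : Type*}

/-- `u` is a **hat**: its typed edges are exactly `e_v = u–v` with `v ∉ {u, a₁, a₂}`, `e₁ = u–a₁`,
`e₂ = u–a₂` (the marks `o, a₃, b` are carried along for uniformity with `IsMarkedHat`). -/
def IsHat (ends : E → Sym2 V) (_o a₁ a₂ _a₃ _b : V) (F : Finset E) (u : V) : Prop :=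
  ∃ (v : V) (e_v e₁ e₂ : E), v ≠ u ∧ v ≠ a₁ ∧ v ≠ a₂ ∧
    e_v ∈ F ∧ e₁ ∈ F ∧ e₂ ∈ F ∧ e_v ≠ e₁ ∧ e_v ≠ e₂ ∧ e₁ ≠ e₂ ∧
    ends e_v = s(u, v) ∧ ends e₁ = s(u, a₁) ∧ ends e₂ = s(u, a₂) ∧
    ∀ e ∈ F, u ∈ ends e → e = e_v ∨ e = e₁ ∨ e = e₂

/-- Every unmarked vertex touched by a typed edge is a hat. -/
def Hats (ends : E → Sym2 V) (o a₁ a₂ a₃ b : V) (F : Finset E) : Prop :=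
  ∀ u, u ≠ o → u ≠ a₁ → u ≠ a₂ → u ≠ a₃ → u ≠ b → (∃ e ∈ F, u ∈ ends e) →
    IsHat ends o a₁ a₂ a₃ b F u

variable {ends : E → Sym2 V} {o a₁ a₂ a₃ b : V} {F : Finset E}

/-- A marked hat is a hat. -/
theorem IsHat.of_isMarkedHat {u : V} (huo : u ≠ o) (hu3 : u ≠ a₃) (hub : u ≠ b)
    (h : IsMarkedHat ends o a₁ a₂ a₃ b F u) : IsHat ends o a₁ a₂ a₃ b F u := by
  obtain ⟨v, e_v, e₁, e₂, hvm, hv1, hv2, hrest⟩ := h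
  refine ⟨v, e_v, e₁, e₂, ?_, hv1, hv2, hrest⟩
  rcases hvm with rfl | rfl | rfl
  · exact huo.symm
  · exact hu3.symm
  · exact hub.symm

/-- Marked hats only are hats. -/
theorem Hats.of_markedHats (h : MarkedHats ends o a₁ a₂ a₃ b F) : Hats ends o a₁ a₂ a₃ b F :=
  fun u huo hu1 hu2 hu3 hub hu => IsHat.of_isMarkedHat huo hu3 hub (h u huo hu1 hu2 hu3 hub hu)

variable [DecidableEq E]

/-- A hat stays a hat when an edge not at it is removed from the typed set. -/
theorem IsHat.erase {u : V} {e₀ : E} (hx : u ∉ ends e₀) (h : IsHat ends o a₁ a₂ a₃ b F u) :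
    IsHat ends o a₁ a₂ a₃ b (F.erase e₀) u := by
  obtain ⟨v, e_v, e₁, e₂, hvu, hv1, hv2, hvF, h1F, h2F, hev1, hev2, he12, hv, h1, h2, honly⟩ := h
  have hne : ∀ e, u ∈ ends e → e ≠ e₀ := fun e hue he => hx (he ▸ hue)
  refine ⟨v, e_v, e₁, e₂, hvu, hv1, hv2,
    Finset.mem_erase.2 ⟨hne e_v (by rw [hv]; exact Sym2.mem_mk_left _ _), hvF⟩,
    Finset.mem_erase.2 ⟨hne e₁ (by rw [h1]; exact Sym2.mem_mk_left _ _), h1F⟩,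
    Finset.mem_erase.2 ⟨hne e₂ (by rw [h2]; exact Sym2.mem_mk_left _ _), h2F⟩,
    hev1, hev2, he12, hv, h1, h2, fun e he hue => honly e (Finset.mem_of_mem_erase he) hue⟩

/-- A hat stays a hat under the re-mapping of another hat's edges, when it is not an end of the
re-mapped edges nor of their new ends. -/
theorem IsHat.hatEnds {u : V} {e_v e₁ : E} {v : V} (hev1 : e_v ≠ e₁) (hxv : u ∉ ends e_v)
    (hx1 : u ∉ ends e₁) (huv : u ≠ v) (hu1 : u ≠ a₁) (hu2 : u ≠ a₂)
    (h : IsHat ends o a₁ a₂ a₃ b F u) :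
    IsHat (hatEnds ends e_v e₁ v a₁ a₂) o a₁ a₂ a₃ b F u := by
  obtain ⟨v', f_v, f₁, f₂, hvu, hv1, hv2, hvF, h1F, h2F, hfv1, hfv2, hf12, hfv, hf1, hf2, honly⟩ := h
  have hne : ∀ e, u ∈ ends e → e ≠ e_v ∧ e ≠ e₁ :=
    fun e hue => ⟨fun he => hxv (he ▸ hue), fun he => hx1 (he ▸ hue)⟩
  have hkv := hne f_v (by rw [hfv]; exact Sym2.mem_mk_left _ _)
  have hk1 := hne f₁ (by rw [hf1]; exact Sym2.mem_mk_left _ _)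
  have hk2 := hne f₂ (by rw [hf2]; exact Sym2.mem_mk_left _ _)
  refine ⟨v', f_v, f₁, f₂, hvu, hv1, hv2, hvF, h1F, h2F, hfv1, hfv2, hf12,
    by rw [hatEnds_other hkv.1 hkv.2]; exact hfv, by rw [hatEnds_other hk1.1 hk1.2]; exact hf1,
    by rw [hatEnds_other hk2.1 hk2.2]; exact hf2, fun e he hue => ?_⟩
  by_cases hev : e = e_v
  · subst hev
    rw [hatEnds_ev hev1] at hue
    rcases Sym2.mem_iff.1 hue with h' | h'
    · exact absurd h' huv
    · exact absurd h' hu1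
  by_cases he1 : e = e₁
  · subst he1
    rw [hatEnds_e1] at hue
    rcases Sym2.mem_iff.1 hue with h' | h'
    · exact absurd h' huv
    · exact absurd h' hu2
  rw [hatEnds_other hev he1] at hue
  exact honly e he hue

end Hats

/-! ## Eliminating the hats -/

section Elimination

variable {V : Type*} {E : Type*} [DecidableEq V] [Fintype E] [DecidableEq E]
variable {R : Type*} [Field R] [LinearOrder R] [IsStrictOrderedRing R]

/-- **Row 2′TRI on the hat class**: marks `MarksDistinct`, the typed set loop-free, mixed types on
every typed edge with an unmarked end, every unmarked typed vertex a hat. Induction on `|F|`: a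
hat with a marked third neighbour is eliminated by `typedCount_hat`, two adjacent hats by
`nonneg_of_hatPair`; the all-marked base is typer-1's `K5.typedCount_K3_nonneg_multi`. -/
theorem typedCount_nonneg_of_hats :
    ∀ (F : Finset E) (ends : E → Sym2 V) (o a₁ a₂ a₃ b : V) (τ : E → ℕ),
      MarksDistinct o a₁ a₂ a₃ b → (∀ e ∈ F, ¬ (ends e).IsDiag) →
      (∀ e ∈ F, (∃ p ∈ ends e, p ≠ o ∧ p ≠ a₁ ∧ p ≠ a₂ ∧ p ≠ a₃ ∧ p ≠ b) → τ e = 1 ∨ τ e = 2) →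
      Hats ends o a₁ a₂ a₃ b F →
      0 ≤ typedCount F (fun _ => false) τ
        (K3 ends o a₁ a₂ a₃ b : Config E → Config E → Config E → R) := by
  intro F
  induction' hn : F.card using Nat.strong_induction_on with n ih generalizing F
  intro ends o a₁ a₂ a₃ b τ hm hloop hτ hhats
  by_cases hall : AllMarked ends o a₁ a₂ a₃ b F
  · exact K5.typedCount_K3_nonneg_multi ends hm.1.1 hm.1.2.1 hm.1.2.2.1 hm.1.2.2.2.1
      hm.1.2.2.2.2.1 hm.1.2.2.2.2.2.1 hm.1.2.2.2.2.2.2 hm.2 F τ hloop hall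
  -- an unmarked typed vertex, hence a hat
  obtain ⟨e₀, he₀, u, hu₀, huo, hu1, hu2, hu3, hub⟩ := exists_unmarked_of_not_allMarked hall
  obtain ⟨v, e_v, e₁, e₂, hvu, hv1, hv2, hvF, h1F, h2F, hev1, hev2, he12, hv, h1, h2, honly⟩ :=
    hhats u huo hu1 hu2 hu3 hub ⟨e₀, he₀, hu₀⟩
  have hτv : τ e_v = 1 ∨ τ e_v = 2 :=
    hτ e_v hvF ⟨u, by rw [hv]; exact Sym2.mem_mk_left _ _, huo, hu1, hu2, hu3, hub⟩
  have hτ1 : τ e₁ = 1 ∨ τ e₁ = 2 :=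
    hτ e₁ h1F ⟨u, by rw [h1]; exact Sym2.mem_mk_left _ _, huo, hu1, hu2, hu3, hub⟩
  have hτ2 : τ e₂ = 1 ∨ τ e₂ = 2 :=
    hτ e₂ h2F ⟨u, by rw [h2]; exact Sym2.mem_mk_left _ _, huo, hu1, hu2, hu3, hub⟩
  -- an unmarked vertex other than `u` is not an end of `u`'s edges
  have hnot_ends : ∀ x, x ≠ u → x ≠ v → x ≠ a₁ → x ≠ a₂ →
      x ∉ ends e_v ∧ x ∉ ends e₁ ∧ x ∉ ends e₂ := by
    intro x hxu hxv hx1 hx2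
    refine ⟨fun h => ?_, fun h => ?_, fun h => ?_⟩
    · rw [hv] at h
      rcases Sym2.mem_iff.1 h with h' | h'
      · exact hxu h'
      · exact hxv h'
    · rw [h1] at h
      rcases Sym2.mem_iff.1 h with h' | h'
      · exact hxu h'
      · exact hx1 h'
    · rw [h2] at h
      rcases Sym2.mem_iff.1 h with h' | h'
      · exact hxu h'
      · exact hx2 h'
  by_cases hvm : v = o ∨ v = a₃ ∨ v = b
  · -- CASE M: the third neighbour is a mark — the hat rule
    have hcl : ∀ e, u ∈ ends e → e ≠ e_v → e ≠ e₁ → e ≠ e₂ →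
        e ∉ F ∧ (fun _ : E => false) e = false := by
      intro e hue h₁ h₂ h₃
      refine ⟨fun heF => ?_, rfl⟩
      rcases honly e heF hue with h | h | h
      · exact h₁ h
      · exact h₂ h
      · exact h₃ h
    rw [typedCount_hat ends o a₁ a₂ a₃ b hv h1 h2 hev1 hev2 he12 huo hu1 hu2 hu3 hub F hvF h1F h2F
      (fun _ => false) hcl τ hτv hτ1 hτ2, update_false_false]
    refine Finset.sum_nonneg fun t₁ _ => Finset.sum_nonneg fun t₂ _ =>
      mul_nonneg (Nat.cast_nonneg _) ?_
    set ends' := hatEnds ends e_v e₁ v a₁ a₂ with hends'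
    have hcard : (F.erase e₂).card < n := hn ▸ Finset.card_erase_lt_of_mem h2F
    have hmark_v : v = o ∨ v = a₁ ∨ v = a₂ ∨ v = a₃ ∨ v = b := by
      rcases hvm with h | h | h
      · exact Or.inl h
      · exact Or.inr (Or.inr (Or.inr (Or.inl h)))
      · exact Or.inr (Or.inr (Or.inr (Or.inr h)))
    have hends'_marks : ∀ e, e = e_v ∨ e = e₁ →
        ∀ p ∈ ends' e, p = o ∨ p = a₁ ∨ p = a₂ ∨ p = a₃ ∨ p = b := by
      intro e he p hp
      rcases he with rfl | rfl
      · rw [hends', hatEnds_ev hev1] at hp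
        rcases Sym2.mem_iff.1 hp with rfl | rfl
        · exact hmark_v
        · exact Or.inr (Or.inl rfl)
      · rw [hends', hatEnds_e1] at hp
        rcases Sym2.mem_iff.1 hp with rfl | rfl
        · exact hmark_v
        · exact Or.inr (Or.inr (Or.inl rfl))
    have hother : ∀ e, e ≠ e_v → e ≠ e₁ → ends' e = ends e := fun e h₁ h₂ => by
      rw [hends', hatEnds_other h₁ h₂]
    have hunm : ∀ x, x ≠ o → x ≠ a₁ → x ≠ a₂ → x ≠ a₃ → x ≠ b → x ≠ v := by
      intro x hxo hx1 hx2 hx3 hxb hxv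
      rcases hvm with h | h | h
      · exact hxo (hxv.trans h)
      · exact hx3 (hxv.trans h)
      · exact hxb (hxv.trans h)
    refine ih _ hcard (F.erase e₂) rfl ends' o a₁ a₂ a₃ b _ hm ?_ ?_ ?_
    · -- loop-free
      intro e he
      by_cases hev : e = e_v
      · subst hev
        rw [hends', hatEnds_ev hev1, Sym2.mk_isDiag_iff]
        exact hv1
      by_cases he1 : e = e₁
      · subst he1
        rw [hends', hatEnds_e1, Sym2.mk_isDiag_iff]
        exact hv2
      rw [hother e hev he1]
      exact hloop e (Finset.mem_of_mem_erase he)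
    · -- mixed types on the edges with an unmarked end
      intro e he ⟨p, hp, hpo, hp1, hp2, hp3, hpb⟩
      by_cases hev : e = e_v
      · exfalso
        rcases hends'_marks e (Or.inl hev) p hp with h | h | h | h | h
        · exact hpo h
        · exact hp1 h
        · exact hp2 h
        · exact hp3 h
        · exact hpb h
      by_cases he1 : e = e₁
      · exfalso
        rcases hends'_marks e (Or.inr he1) p hp with h | h | h | h | h
        · exact hpo h
        · exact hp1 h
        · exact hp2 h
        · exact hp3 h
        · exact hpb h
      rw [Function.update_of_ne he1, Function.update_of_ne hev]
      exact hτ e (Finset.mem_of_mem_erase he)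
        ⟨p, by rwa [hother e hev he1] at hp, hpo, hp1, hp2, hp3, hpb⟩
    · -- every unmarked typed vertex is still a hat
      intro x hxo hx1 hx2 hx3 hxb ⟨e, he, hxe⟩
      have hev : e ≠ e_v := fun h => by
        rcases hends'_marks e (Or.inl h) x hxe with h' | h' | h' | h' | h'
        · exact hxo h'
        · exact hx1 h'
        · exact hx2 h'
        · exact hx3 h'
        · exact hxb h'
      have he1 : e ≠ e₁ := fun h => by
        rcases hends'_marks e (Or.inr h) x hxe with h' | h' | h' | h' | h'
        · exact hxo h'
        · exact hx1 h'
        · exact hx2 h'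
        · exact hx3 h'
        · exact hxb h'
      have he2 : e ≠ e₂ := (Finset.mem_erase.1 he).1
      rw [hother e hev he1] at hxe
      have hxu : x ≠ u := fun h => by
        subst h
        rcases honly e (Finset.mem_of_mem_erase he) hxe with h' | h' | h'
        · exact hev h'
        · exact he1 h'
        · exact he2 h'
      have hxv : x ≠ v := hunm x hxo hx1 hx2 hx3 hxb
      obtain ⟨hnv, hn1, hn2⟩ := hnot_ends x hxu hxv hx1 hx2
      exact (IsHat.erase hn2 (hhats x hxo hx1 hx2 hx3 hxb
        ⟨e, Finset.mem_of_mem_erase he, hxe⟩)).hatEnds hev1 hnv hn1 hxv hx1 hx2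
  · -- CASE P: the third neighbour `v` is unmarked, hence a hat adjacent to `u`
    have hvo : v ≠ o := fun h => hvm (Or.inl h)
    have hv3 : v ≠ a₃ := fun h => hvm (Or.inr (Or.inl h))
    have hvb : v ≠ b := fun h => hvm (Or.inr (Or.inr h))
    obtain ⟨x, g_v, g₁, g₂, hxv, hx1, hx2, hgvF, hg1F, hg2F, hgv1, hgv2, hg12, hgv, hg1, hg2,
      honly'⟩ := hhats v hvo hv1 hv2 hv3 hvb ⟨e_v, hvF, by rw [hv]; exact Sym2.mem_mk_right _ _⟩
    -- `u`'s edge to `v` is `v`'s non-root edge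
    have hev_gv : e_v = g_v := by
      rcases honly' e_v hvF (by rw [hv]; exact Sym2.mem_mk_right _ _) with h | h | h
      · exact h
      · exfalso
        rw [h, hg1] at hv
        rcases Sym2.eq_iff.1 hv with ⟨h', _⟩ | ⟨_, h'⟩
        · exact hvu h'
        · exact hu1 h'.symm
      · exfalso
        rw [h, hg2] at hv
        rcases Sym2.eq_iff.1 hv with ⟨h', _⟩ | ⟨_, h'⟩
        · exact hvu h'
        · exact hu2 h'.symm
    subst hev_gv
    have hwonly : ∀ e ∈ F, v ∈ ends e → e = e_v ∨ e = g₁ ∨ e = g₂ := honly'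
    have hτg1 : τ g₁ = 1 ∨ τ g₁ = 2 :=
      hτ g₁ hg1F ⟨v, by rw [hg1]; exact Sym2.mem_mk_left _ _, hvo, hv1, hv2, hv3, hvb⟩
    have hτg2 : τ g₂ = 1 ∨ τ g₂ = 2 :=
      hτ g₂ hg2F ⟨v, by rw [hg2]; exact Sym2.mem_mk_left _ _, hvo, hv1, hv2, hv3, hvb⟩
    refine nonneg_of_hatPair ends o a₁ a₂ a₃ b hv h1 h2 hg1 hg2 hm.1.1 hvu.symm huo hu1 hu2 hu3 hub
      hvo hv1 hv2 hv3 hvb F hvF h1F h2F hg1F hg2F honly hwonly τ hτv hτ1 hτ2 hτg1 hτg2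
      fun σ hσ => ?_
    set F₅ := ((((F.erase e_v).erase e₁).erase e₂).erase g₁).erase g₂ with hF₅
    have hF₅sub : F₅ ⊆ F := fun e he =>
      Finset.mem_of_mem_erase (Finset.mem_of_mem_erase (Finset.mem_of_mem_erase
        (Finset.mem_of_mem_erase (Finset.mem_of_mem_erase he))))
    have hcard : F₅.card < n := by
      rw [← hn]
      calc F₅.card ≤ (F.erase e_v).card := Finset.card_le_card fun e he =>
            Finset.mem_of_mem_erase (Finset.mem_of_mem_erase (Finset.mem_of_mem_erase
              (Finset.mem_of_mem_erase he)))
        _ < F.card := Finset.card_erase_lt_of_mem hvF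
    refine ih _ hcard F₅ rfl ends o a₁ a₂ a₃ b σ hm (fun e he => hloop e (hF₅sub he)) ?_ ?_
    · intro e he hp
      rw [hσ e he]
      exact hτ e (hF₅sub he) hp
    · -- every unmarked typed vertex of `F₅` is a hat of `F₅`
      intro y hyo hy1 hy2 hy3 hyb ⟨e, he, hye⟩
      have hg2e : e ≠ g₂ := (Finset.mem_erase.1 he).1
      have hg1e : e ≠ g₁ := (Finset.mem_erase.1 (Finset.mem_erase.1 he).2).1
      have he2 : e ≠ e₂ := (Finset.mem_erase.1 (Finset.mem_erase.1 (Finset.mem_erase.1 he).2).2).1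
      have he1 : e ≠ e₁ :=
        (Finset.mem_erase.1 (Finset.mem_erase.1 (Finset.mem_erase.1 (Finset.mem_erase.1 he).2).2).2).1
      have hev : e ≠ e_v := (Finset.mem_erase.1 (Finset.mem_erase.1 (Finset.mem_erase.1
        (Finset.mem_erase.1 (Finset.mem_erase.1 he).2).2).2).2).1
      have hyu : y ≠ u := fun h => by
        subst h
        rcases honly e (hF₅sub he) hye with h' | h' | h'
        · exact hev h'
        · exact he1 h'
        · exact he2 h'
      have hyv : y ≠ v := fun h => by
        subst h
        rcases hwonly e (hF₅sub he) hye with h' | h' | h'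
        · exact hev h'
        · exact hg1e h'
        · exact hg2e h'
      obtain ⟨hnv, hn1, hn2⟩ := hnot_ends y hyu hyv hy1 hy2
      have hng1 : y ∉ ends g₁ := fun h => by
        rw [hg1] at h
        rcases Sym2.mem_iff.1 h with h' | h'
        · exact hyv h'
        · exact hy1 h'
      have hng2 : y ∉ ends g₂ := fun h => by
        rw [hg2] at h
        rcases Sym2.mem_iff.1 h with h' | h'
        · exact hyv h'
        · exact hy2 h'
      exact ((((hhats y hyo hy1 hy2 hy3 hyb ⟨e, hF₅sub he, hye⟩).erase hnv).erase hn1).erase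
        hn2).erase hng1 |>.erase hng2

end Elimination

/-! ## The conjunct in the core -/

section Core

variable {V : Type*} {E : Type*} [DecidableEq V] [Fintype E] [DecidableEq E]

/-- **The core with an unmarked typed vertex that is not a hat.** -/
structure ResidualCoreNHat (ends : E → Sym2 V) (o a₁ a₂ a₃ b : V) (F : Finset E) : Prop where
  core : ResidualCore ends o a₁ a₂ a₃ b F
  not_hats : ¬ Hats ends o a₁ a₂ a₃ b F

omit [DecidableEq V] [Fintype E] in
/-- `ResidualCoreNHat ⊆ ResidualCoreNH`. -/
theorem ResidualCoreNHat.coreNH {ends : E → Sym2 V} {o a₁ a₂ a₃ b : V} {F : Finset E}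
    (h : ResidualCoreNHat ends o a₁ a₂ a₃ b F) : ResidualCoreNH ends o a₁ a₂ a₃ b F :=
  ⟨h.core, fun hm => h.not_hats (Hats.of_markedHats hm)⟩

end Core

section Closure

variable (R : Type*) [Field R] [LinearOrder R] [IsStrictOrderedRing R]

/-- **Row 2′TRI on `ResidualCoreNHat`, over every finite graph.** -/
def ResidualCoreNHat_all : Prop :=
  ∀ (V E : Type) [Fintype V] [DecidableEq V] [Fintype E] [DecidableEq E]
    (ends : E → Sym2 V) (o a₁ a₂ a₃ b : V) (F : Finset E) (τ : E → ℕ),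
    (∀ e ∈ F, τ e = 1 ∨ τ e = 2) → ResidualCoreNHat ends o a₁ a₂ a₃ b F →
      0 ≤ typedCount F (fun _ => false) τ
        (K3 ends o a₁ a₂ a₃ b : Config E → Config E → Config E → R)

/-- **THE CRUX OF RECORD FROM (TRI) ON THE CORE INSTANCES WITH AN UNMARKED TYPED VERTEX THAT IS NOT
A HAT** — unconditional: the hat instances are the hat rule and the adjacent-hats step over
typer-1's `K₅` multigraph theorem. -/
theorem HCov_all_of_residualCoreNHat_all (hc : ResidualCoreNHat_all R) : HCov_all R := by
  refine HCov_all_of_residualCore_all R ?_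
  intro V E _ _ _ _ ends o a₁ a₂ a₃ b F τ hτ hcore
  by_cases hh : Hats ends o a₁ a₂ a₃ b F
  · exact typedCount_nonneg_of_hats F ends o a₁ a₂ a₃ b τ hcore.marks
      hcore.residualConR.residualCon.residual.reduced.no_loop (fun e he _ => hτ e he) hh
  · exact hc V E ends o a₁ a₂ a₃ b F τ hτ ⟨hcore, hh⟩

end Closure

end TypedRed

end CovForm

end Summit.Ventures.PercRepro2
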